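import Summits.BirchSwinnertonDyer.BirchSwinnertonDyer.Theorems.PrintCFramBottomClassIndexLawFiveLeKrizLiBindersAnchor11
import Summits.BirchSwinnertonDyer.BirchSwinnertonDyer.Theorems.PrintCFramBottomClassIndexLawFiveLeKrizLiBindersAnchor19
import Summits.BirchSwinnertonDyer.BirchSwinnertonDyer.Theorems.PrintCFramBottomClassIndexLawFiveLeKrizLiBindersAnchor43
import Summits.BirchSwinnertonDyer.BirchSwinnertonDyer.Theorems.PrintCFramBottomClassIndexLawFiveLeKrizLiBindersAnchor67
import Summits.BirchSwinnertonDyer.BirchSwinnertonDyer.Theorems.PrintCFramBottomClassIndexLawFiveLeKrizLiBindersAnchor163EndState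
import HarnessLib

/-!
# Crux `PrintCFram.BottomClassIndexLawFiveLe` (stmt-BirchSwinnertonDyer-20372), line `eisenstein-resource-bdp-line` (registered skeleton):
# the composition's KRIZ–LI DATUM `hKLd` for the five BASE CURVES `A(11), A(19), A(43), A(67), A(163)`, modulo the Heegner DATA and the `L`-value —
# `exists_krizLiDatum_A{11,19,43,67,163}`
# (cell `bsd-print-cfram`, width seat `bsd-line-cfram-p1-w5` g0; THEOREMS ONLY, `--supports` 20372; BSD is not proved by any of this)

HONEST FRAMING. Nothing here proves BSD or closes a stub. Untwisted companion of `…KrizLi4Datum{11A,11B,19A,19B,43and67}.lean`: the existential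
`hKLd` of the case split of `EisensteinResourceBdpLine.BottomClassIndexLawFiveLe_of` (`∃ N K Dt H ι P f ψ ω εK, N_W = N ∧ IsImaginaryQuadratic K ∧
SatisfiesHeegnerHypothesis N K ∧ Odd d_K ∧ d_K < −4 ∧ L(W^{(d_K)},1) ≠ 0 ∧ ι(P) = heegnerPointComplex Dt H ∧ ψ.IsPrimitive ∧ IsTeichmullerCharacter ω ∧
hss ∧ (1) ∧ (3) ∧ IsKroneckerCharacterOf K εK ∧ (4)`) is inhabited VERBATIM for every `W ∼ A(p)`, `p ∈ {11, 19, 43, 67, 163}`, over every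
imaginary quadratic `K''` of discriminant `−7` (`−31` at `p = 19`), from w3 g2's `KrizLiBinders.exists_krizLiCharacterBlock_A{p}` and
`satisfiesHeegnerHypothesis_A{p}` (`…KrizLiBindersAnchor{11,19,43,67}`, `…Anchor163`/`…Anchor163EndState`), given — as hypotheses — the Heegner
data `(Dt, H, ι, P)` of `W` over `K''` at level `N_W` and `L(W^{(d_K)}, 1) ≠ 0`. With the twisted files this covers every on-locus class of the
`≥ 5` rank-one window at `p ≥ 11`. beyond-print theorem: NO. References: [KrizLi2019] Thm. 1.20, Rem. 1.21; [GrossLMS1991] §1.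
-/

set_option autoImplicit false
set_option linter.dupNamespace false

noncomputable section

open scoped Classical

namespace Summit.BirchSwinnertonDyer.BirchSwinnertonDyer.Theorems.PrintCFram.KrizLiBindersTwisted

open scoped NumberTheorySymbols
open WeierstrassCurve IsDedekindDomain NumberField DirichletCharacter Literature.NumberTheory.LFunctions
  Literature.NumberTheory.EllipticCurves Literature.NumberTheory.EllipticCurves.ModularForms
  Literature.NumberTheory.EllipticCurves.Rank1Residual Literature.NumberTheory.EllipticCurves.KrizLi2019
  Literature.NumberTheory.QuadraticFields
  Summit.BirchSwinnertonDyer.Rank1Residual Summit.BirchSwinnertonDyer.Rank1Residual.X12.O11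
  Summit.BirchSwinnertonDyer.BirchSwinnertonDyer.Theorems.PrintCFram

/-- **The composition's Kriz–Li datum for the BASE CURVE `A(11)` (every `W ∼ cm11`) over a Heegner field of discriminant `-7`, modulo the
Heegner DATA and the `L`-value**: the existential `hKLd` of the case split of `EisensteinResourceBdpLine.BottomClassIndexLawFiveLe_of`, VERBATIM,
from w3 g2's `KrizLiBinders.exists_krizLiCharacterBlock_A11` and `KrizLiBinders.satisfiesHeegnerHypothesis_A11` — the untwisted companion of
`exists_krizLiDatum_<label>` (`…KrizLi4Datum*`). [cite: KrizLi2019, Thm. 1.20 (pp. 7–8), Rem. 1.21] [cite: GrossLMS1991, §1 (p. 235)] -/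
theorem exists_krizLiDatum_A11 [Fact (Nat.Prime 11)] (W : WeierstrassCurve ℚ) [W.IsElliptic] (hiso : IsIsogenous W cm11)
    (K : Type) [Field K] [NumberField K] (hK : IsImaginaryQuadratic K) (hdK : NumberField.discr K = -7)
    [NeZero (NumberField.discr K).natAbs] [NeZero (W.conductorNorm ℤ)]
    (Dt : ModularParametrizationData W (W.conductorNorm ℤ)) (H : HeegnerDatum (W.conductorNorm ℤ) (NumberField.discr K))
    (ι : K →+* ℂ) (P : (W.baseChange K).toAffine.Point)
    (hP : WeierstrassCurve.Affine.Point.map ι.toRatAlgHom P = heegnerPointComplex Dt H)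
    (hLt : (W.quadraticTwist (NumberField.discr K : ℚ)).entireLFunction 1 ≠ 0) :
    ∃ (N : ℕ) (_ : NeZero N) (K : Type) (_ : Field K) (_ : NumberField K) (Dt : ModularParametrizationData W N)
      (H : HeegnerDatum N (NumberField.discr K)) (ι : K →+* ℂ) (P : (W.baseChange K).toAffine.Point)
      (f : ℕ) (_ : NeZero f) (ψ : DirichletCharacter ℚ_[11] f) (ω : DirichletCharacter ℚ_[11] 11)
      (εK : DirichletCharacter ℚ_[11] (NumberField.discr K).natAbs),
      W.conductorNorm ℤ = N ∧ IsImaginaryQuadratic K ∧ SatisfiesHeegnerHypothesis N K ∧ Odd (NumberField.discr K) ∧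
      NumberField.discr K < -4 ∧ (W.quadraticTwist (NumberField.discr K : ℚ)).entireLFunction 1 ≠ 0 ∧
      WeierstrassCurve.Affine.Point.map ι.toRatAlgHom P = heegnerPointComplex Dt H ∧
      ψ.IsPrimitive ∧ IsTeichmullerCharacter ω ∧
      (∀ ℓ : ℕ, ℓ.Prime → ¬ (ℓ ∣ 11 * W.conductorNorm ℤ) →
        ‖((W.LFunction ℓ : ℤ) : ℚ_[11]) - (ψ (ℓ : ZMod f) + ψ⁻¹ (ℓ : ZMod f) * ω (ℓ : ZMod 11))‖ < 1) ∧
      ψ ((11 : ℕ) : ZMod f) ≠ 1 ∧ primVal (invMulOmega ψ ω) 11 ≠ 1 ∧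
      (∀ ℓ : ℕ, (hℓ : ℓ.Prime) → ℓ ≠ 11 →
        (haveI := Fact.mk hℓ; ¬ W.HasGoodReductionAtPrime ℓ ∧ ¬ W.HasMultiplicativeReductionAtPrime ℓ) →
        ψ (ℓ : ZMod f) ≠ 1 ∧ primVal (invMulOmega ψ ω) ℓ ≠ 1) ∧
      IsKroneckerCharacterOf K εK ∧
      ¬ (‖bernoulliOnePrim (bernoulliCharOne ψ εK) * bernoulliOnePrim (bernoulliCharTwo ψ εK ω)‖ ≤ ((11 : ℕ) : ℝ)⁻¹) := by
  obtain ⟨f, hf, ψ, ω, εK, hψ, hω, hss, ⟨h1, h1'⟩, h3, hεK, h4, -⟩ :=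
    KrizLiBinders.exists_krizLiCharacterBlock_A11 W hiso K hK.1 hdK
  have hodd : Odd (NumberField.discr K) := by rw [hdK]; decide
  have hd4 : NumberField.discr K < -4 := by rw [hdK]; norm_num
  exact ⟨W.conductorNorm ℤ, inferInstance, K, inferInstance, inferInstance, Dt, H, ι, P, f, hf, ψ, ω, εK, rfl, hK,
    KrizLiBinders.satisfiesHeegnerHypothesis_A11 W hiso K hK.1 hdK, hodd, hd4, hLt, hP, hψ, hω, hss, h1, h1', h3, hεK, h4⟩

/-- **The composition's Kriz–Li datum for the BASE CURVE `A(19)` (every `W ∼ cm19`) over a Heegner field of discriminant `-31`, modulo the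
Heegner DATA and the `L`-value**: the existential `hKLd` of the case split of `EisensteinResourceBdpLine.BottomClassIndexLawFiveLe_of`, VERBATIM,
from w3 g2's `KrizLiBinders.exists_krizLiCharacterBlock_A19` and `KrizLiBinders.satisfiesHeegnerHypothesis_A19` — the untwisted companion of
`exists_krizLiDatum_<label>` (`…KrizLi4Datum*`). [cite: KrizLi2019, Thm. 1.20 (pp. 7–8), Rem. 1.21] [cite: GrossLMS1991, §1 (p. 235)] -/
theorem exists_krizLiDatum_A19 [Fact (Nat.Prime 19)] (W : WeierstrassCurve ℚ) [W.IsElliptic] (hiso : IsIsogenous W cm19)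
    (K : Type) [Field K] [NumberField K] (hK : IsImaginaryQuadratic K) (hdK : NumberField.discr K = -31)
    [NeZero (NumberField.discr K).natAbs] [NeZero (W.conductorNorm ℤ)]
    (Dt : ModularParametrizationData W (W.conductorNorm ℤ)) (H : HeegnerDatum (W.conductorNorm ℤ) (NumberField.discr K))
    (ι : K →+* ℂ) (P : (W.baseChange K).toAffine.Point)
    (hP : WeierstrassCurve.Affine.Point.map ι.toRatAlgHom P = heegnerPointComplex Dt H)
    (hLt : (W.quadraticTwist (NumberField.discr K : ℚ)).entireLFunction 1 ≠ 0) :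
    ∃ (N : ℕ) (_ : NeZero N) (K : Type) (_ : Field K) (_ : NumberField K) (Dt : ModularParametrizationData W N)
      (H : HeegnerDatum N (NumberField.discr K)) (ι : K →+* ℂ) (P : (W.baseChange K).toAffine.Point)
      (f : ℕ) (_ : NeZero f) (ψ : DirichletCharacter ℚ_[19] f) (ω : DirichletCharacter ℚ_[19] 19)
      (εK : DirichletCharacter ℚ_[19] (NumberField.discr K).natAbs),
      W.conductorNorm ℤ = N ∧ IsImaginaryQuadratic K ∧ SatisfiesHeegnerHypothesis N K ∧ Odd (NumberField.discr K) ∧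
      NumberField.discr K < -4 ∧ (W.quadraticTwist (NumberField.discr K : ℚ)).entireLFunction 1 ≠ 0 ∧
      WeierstrassCurve.Affine.Point.map ι.toRatAlgHom P = heegnerPointComplex Dt H ∧
      ψ.IsPrimitive ∧ IsTeichmullerCharacter ω ∧
      (∀ ℓ : ℕ, ℓ.Prime → ¬ (ℓ ∣ 19 * W.conductorNorm ℤ) →
        ‖((W.LFunction ℓ : ℤ) : ℚ_[19]) - (ψ (ℓ : ZMod f) + ψ⁻¹ (ℓ : ZMod f) * ω (ℓ : ZMod 19))‖ < 1) ∧
      ψ ((19 : ℕ) : ZMod f) ≠ 1 ∧ primVal (invMulOmega ψ ω) 19 ≠ 1 ∧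
      (∀ ℓ : ℕ, (hℓ : ℓ.Prime) → ℓ ≠ 19 →
        (haveI := Fact.mk hℓ; ¬ W.HasGoodReductionAtPrime ℓ ∧ ¬ W.HasMultiplicativeReductionAtPrime ℓ) →
        ψ (ℓ : ZMod f) ≠ 1 ∧ primVal (invMulOmega ψ ω) ℓ ≠ 1) ∧
      IsKroneckerCharacterOf K εK ∧
      ¬ (‖bernoulliOnePrim (bernoulliCharOne ψ εK) * bernoulliOnePrim (bernoulliCharTwo ψ εK ω)‖ ≤ ((19 : ℕ) : ℝ)⁻¹) := by
  obtain ⟨f, hf, ψ, ω, εK, hψ, hω, hss, ⟨h1, h1'⟩, h3, hεK, h4, -⟩ :=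
    KrizLiBinders.exists_krizLiCharacterBlock_A19 W hiso K hK.1 hdK
  have hodd : Odd (NumberField.discr K) := by rw [hdK]; decide
  have hd4 : NumberField.discr K < -4 := by rw [hdK]; norm_num
  exact ⟨W.conductorNorm ℤ, inferInstance, K, inferInstance, inferInstance, Dt, H, ι, P, f, hf, ψ, ω, εK, rfl, hK,
    KrizLiBinders.satisfiesHeegnerHypothesis_A19 W hiso K hK.1 hdK, hodd, hd4, hLt, hP, hψ, hω, hss, h1, h1', h3, hεK, h4⟩

/-- **The composition's Kriz–Li datum for the BASE CURVE `A(43)` (every `W ∼ cm43`) over a Heegner field of discriminant `-7`, modulo the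
Heegner DATA and the `L`-value**: the existential `hKLd` of the case split of `EisensteinResourceBdpLine.BottomClassIndexLawFiveLe_of`, VERBATIM,
from w3 g2's `KrizLiBinders.exists_krizLiCharacterBlock_A43` and `KrizLiBinders.satisfiesHeegnerHypothesis_A43` — the untwisted companion of
`exists_krizLiDatum_<label>` (`…KrizLi4Datum*`). [cite: KrizLi2019, Thm. 1.20 (pp. 7–8), Rem. 1.21] [cite: GrossLMS1991, §1 (p. 235)] -/
theorem exists_krizLiDatum_A43 [Fact (Nat.Prime 43)] (W : WeierstrassCurve ℚ) [W.IsElliptic] (hiso : IsIsogenous W cm43)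
    (K : Type) [Field K] [NumberField K] (hK : IsImaginaryQuadratic K) (hdK : NumberField.discr K = -7)
    [NeZero (NumberField.discr K).natAbs] [NeZero (W.conductorNorm ℤ)]
    (Dt : ModularParametrizationData W (W.conductorNorm ℤ)) (H : HeegnerDatum (W.conductorNorm ℤ) (NumberField.discr K))
    (ι : K →+* ℂ) (P : (W.baseChange K).toAffine.Point)
    (hP : WeierstrassCurve.Affine.Point.map ι.toRatAlgHom P = heegnerPointComplex Dt H)
    (hLt : (W.quadraticTwist (NumberField.discr K : ℚ)).entireLFunction 1 ≠ 0) :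
    ∃ (N : ℕ) (_ : NeZero N) (K : Type) (_ : Field K) (_ : NumberField K) (Dt : ModularParametrizationData W N)
      (H : HeegnerDatum N (NumberField.discr K)) (ι : K →+* ℂ) (P : (W.baseChange K).toAffine.Point)
      (f : ℕ) (_ : NeZero f) (ψ : DirichletCharacter ℚ_[43] f) (ω : DirichletCharacter ℚ_[43] 43)
      (εK : DirichletCharacter ℚ_[43] (NumberField.discr K).natAbs),
      W.conductorNorm ℤ = N ∧ IsImaginaryQuadratic K ∧ SatisfiesHeegnerHypothesis N K ∧ Odd (NumberField.discr K) ∧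
      NumberField.discr K < -4 ∧ (W.quadraticTwist (NumberField.discr K : ℚ)).entireLFunction 1 ≠ 0 ∧
      WeierstrassCurve.Affine.Point.map ι.toRatAlgHom P = heegnerPointComplex Dt H ∧
      ψ.IsPrimitive ∧ IsTeichmullerCharacter ω ∧
      (∀ ℓ : ℕ, ℓ.Prime → ¬ (ℓ ∣ 43 * W.conductorNorm ℤ) →
        ‖((W.LFunction ℓ : ℤ) : ℚ_[43]) - (ψ (ℓ : ZMod f) + ψ⁻¹ (ℓ : ZMod f) * ω (ℓ : ZMod 43))‖ < 1) ∧
      ψ ((43 : ℕ) : ZMod f) ≠ 1 ∧ primVal (invMulOmega ψ ω) 43 ≠ 1 ∧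
      (∀ ℓ : ℕ, (hℓ : ℓ.Prime) → ℓ ≠ 43 →
        (haveI := Fact.mk hℓ; ¬ W.HasGoodReductionAtPrime ℓ ∧ ¬ W.HasMultiplicativeReductionAtPrime ℓ) →
        ψ (ℓ : ZMod f) ≠ 1 ∧ primVal (invMulOmega ψ ω) ℓ ≠ 1) ∧
      IsKroneckerCharacterOf K εK ∧
      ¬ (‖bernoulliOnePrim (bernoulliCharOne ψ εK) * bernoulliOnePrim (bernoulliCharTwo ψ εK ω)‖ ≤ ((43 : ℕ) : ℝ)⁻¹) := by
  obtain ⟨f, hf, ψ, ω, εK, hψ, hω, hss, ⟨h1, h1'⟩, h3, hεK, h4, -⟩ :=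
    KrizLiBinders.exists_krizLiCharacterBlock_A43 W hiso K hK.1 hdK
  have hodd : Odd (NumberField.discr K) := by rw [hdK]; decide
  have hd4 : NumberField.discr K < -4 := by rw [hdK]; norm_num
  exact ⟨W.conductorNorm ℤ, inferInstance, K, inferInstance, inferInstance, Dt, H, ι, P, f, hf, ψ, ω, εK, rfl, hK,
    KrizLiBinders.satisfiesHeegnerHypothesis_A43 W hiso K hK.1 hdK, hodd, hd4, hLt, hP, hψ, hω, hss, h1, h1', h3, hεK, h4⟩

/-- **The composition's Kriz–Li datum for the BASE CURVE `A(67)` (every `W ∼ cm67`) over a Heegner field of discriminant `-7`, modulo the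
Heegner DATA and the `L`-value**: the existential `hKLd` of the case split of `EisensteinResourceBdpLine.BottomClassIndexLawFiveLe_of`, VERBATIM,
from w3 g2's `KrizLiBinders.exists_krizLiCharacterBlock_A67` and `KrizLiBinders.satisfiesHeegnerHypothesis_A67` — the untwisted companion of
`exists_krizLiDatum_<label>` (`…KrizLi4Datum*`). [cite: KrizLi2019, Thm. 1.20 (pp. 7–8), Rem. 1.21] [cite: GrossLMS1991, §1 (p. 235)] -/
theorem exists_krizLiDatum_A67 [Fact (Nat.Prime 67)] (W : WeierstrassCurve ℚ) [W.IsElliptic] (hiso : IsIsogenous W cm67)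
    (K : Type) [Field K] [NumberField K] (hK : IsImaginaryQuadratic K) (hdK : NumberField.discr K = -7)
    [NeZero (NumberField.discr K).natAbs] [NeZero (W.conductorNorm ℤ)]
    (Dt : ModularParametrizationData W (W.conductorNorm ℤ)) (H : HeegnerDatum (W.conductorNorm ℤ) (NumberField.discr K))
    (ι : K →+* ℂ) (P : (W.baseChange K).toAffine.Point)
    (hP : WeierstrassCurve.Affine.Point.map ι.toRatAlgHom P = heegnerPointComplex Dt H)
    (hLt : (W.quadraticTwist (NumberField.discr K : ℚ)).entireLFunction 1 ≠ 0) :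
    ∃ (N : ℕ) (_ : NeZero N) (K : Type) (_ : Field K) (_ : NumberField K) (Dt : ModularParametrizationData W N)
      (H : HeegnerDatum N (NumberField.discr K)) (ι : K →+* ℂ) (P : (W.baseChange K).toAffine.Point)
      (f : ℕ) (_ : NeZero f) (ψ : DirichletCharacter ℚ_[67] f) (ω : DirichletCharacter ℚ_[67] 67)
      (εK : DirichletCharacter ℚ_[67] (NumberField.discr K).natAbs),
      W.conductorNorm ℤ = N ∧ IsImaginaryQuadratic K ∧ SatisfiesHeegnerHypothesis N K ∧ Odd (NumberField.discr K) ∧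
      NumberField.discr K < -4 ∧ (W.quadraticTwist (NumberField.discr K : ℚ)).entireLFunction 1 ≠ 0 ∧
      WeierstrassCurve.Affine.Point.map ι.toRatAlgHom P = heegnerPointComplex Dt H ∧
      ψ.IsPrimitive ∧ IsTeichmullerCharacter ω ∧
      (∀ ℓ : ℕ, ℓ.Prime → ¬ (ℓ ∣ 67 * W.conductorNorm ℤ) →
        ‖((W.LFunction ℓ : ℤ) : ℚ_[67]) - (ψ (ℓ : ZMod f) + ψ⁻¹ (ℓ : ZMod f) * ω (ℓ : ZMod 67))‖ < 1) ∧
      ψ ((67 : ℕ) : ZMod f) ≠ 1 ∧ primVal (invMulOmega ψ ω) 67 ≠ 1 ∧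
      (∀ ℓ : ℕ, (hℓ : ℓ.Prime) → ℓ ≠ 67 →
        (haveI := Fact.mk hℓ; ¬ W.HasGoodReductionAtPrime ℓ ∧ ¬ W.HasMultiplicativeReductionAtPrime ℓ) →
        ψ (ℓ : ZMod f) ≠ 1 ∧ primVal (invMulOmega ψ ω) ℓ ≠ 1) ∧
      IsKroneckerCharacterOf K εK ∧
      ¬ (‖bernoulliOnePrim (bernoulliCharOne ψ εK) * bernoulliOnePrim (bernoulliCharTwo ψ εK ω)‖ ≤ ((67 : ℕ) : ℝ)⁻¹) := by
  obtain ⟨f, hf, ψ, ω, εK, hψ, hω, hss, ⟨h1, h1'⟩, h3, hεK, h4, -⟩ :=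
    KrizLiBinders.exists_krizLiCharacterBlock_A67 W hiso K hK.1 hdK
  have hodd : Odd (NumberField.discr K) := by rw [hdK]; decide
  have hd4 : NumberField.discr K < -4 := by rw [hdK]; norm_num
  exact ⟨W.conductorNorm ℤ, inferInstance, K, inferInstance, inferInstance, Dt, H, ι, P, f, hf, ψ, ω, εK, rfl, hK,
    KrizLiBinders.satisfiesHeegnerHypothesis_A67 W hiso K hK.1 hdK, hodd, hd4, hLt, hP, hψ, hω, hss, h1, h1', h3, hεK, h4⟩

/-- **The composition's Kriz–Li datum for the BASE CURVE `A(163)` (every `W ∼ cm163`) over a Heegner field of discriminant `-7`, modulo the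
Heegner DATA and the `L`-value**: the existential `hKLd` of the case split of `EisensteinResourceBdpLine.BottomClassIndexLawFiveLe_of`, VERBATIM,
from w3 g2's `KrizLiBinders.exists_krizLiCharacterBlock_A163` and `KrizLiBinders.satisfiesHeegnerHypothesis_A163` — the untwisted companion of
`exists_krizLiDatum_<label>` (`…KrizLi4Datum*`). [cite: KrizLi2019, Thm. 1.20 (pp. 7–8), Rem. 1.21] [cite: GrossLMS1991, §1 (p. 235)] -/
theorem exists_krizLiDatum_A163 [Fact (Nat.Prime 163)] (W : WeierstrassCurve ℚ) [W.IsElliptic] (hiso : IsIsogenous W cm163)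
    (K : Type) [Field K] [NumberField K] (hK : IsImaginaryQuadratic K) (hdK : NumberField.discr K = -7)
    [NeZero (NumberField.discr K).natAbs] [NeZero (W.conductorNorm ℤ)]
    (Dt : ModularParametrizationData W (W.conductorNorm ℤ)) (H : HeegnerDatum (W.conductorNorm ℤ) (NumberField.discr K))
    (ι : K →+* ℂ) (P : (W.baseChange K).toAffine.Point)
    (hP : WeierstrassCurve.Affine.Point.map ι.toRatAlgHom P = heegnerPointComplex Dt H)
    (hLt : (W.quadraticTwist (NumberField.discr K : ℚ)).entireLFunction 1 ≠ 0) :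
    ∃ (N : ℕ) (_ : NeZero N) (K : Type) (_ : Field K) (_ : NumberField K) (Dt : ModularParametrizationData W N)
      (H : HeegnerDatum N (NumberField.discr K)) (ι : K →+* ℂ) (P : (W.baseChange K).toAffine.Point)
      (f : ℕ) (_ : NeZero f) (ψ : DirichletCharacter ℚ_[163] f) (ω : DirichletCharacter ℚ_[163] 163)
      (εK : DirichletCharacter ℚ_[163] (NumberField.discr K).natAbs),
      W.conductorNorm ℤ = N ∧ IsImaginaryQuadratic K ∧ SatisfiesHeegnerHypothesis N K ∧ Odd (NumberField.discr K) ∧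
      NumberField.discr K < -4 ∧ (W.quadraticTwist (NumberField.discr K : ℚ)).entireLFunction 1 ≠ 0 ∧
      WeierstrassCurve.Affine.Point.map ι.toRatAlgHom P = heegnerPointComplex Dt H ∧
      ψ.IsPrimitive ∧ IsTeichmullerCharacter ω ∧
      (∀ ℓ : ℕ, ℓ.Prime → ¬ (ℓ ∣ 163 * W.conductorNorm ℤ) →
        ‖((W.LFunction ℓ : ℤ) : ℚ_[163]) - (ψ (ℓ : ZMod f) + ψ⁻¹ (ℓ : ZMod f) * ω (ℓ : ZMod 163))‖ < 1) ∧
      ψ ((163 : ℕ) : ZMod f) ≠ 1 ∧ primVal (invMulOmega ψ ω) 163 ≠ 1 ∧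
      (∀ ℓ : ℕ, (hℓ : ℓ.Prime) → ℓ ≠ 163 →
        (haveI := Fact.mk hℓ; ¬ W.HasGoodReductionAtPrime ℓ ∧ ¬ W.HasMultiplicativeReductionAtPrime ℓ) →
        ψ (ℓ : ZMod f) ≠ 1 ∧ primVal (invMulOmega ψ ω) ℓ ≠ 1) ∧
      IsKroneckerCharacterOf K εK ∧
      ¬ (‖bernoulliOnePrim (bernoulliCharOne ψ εK) * bernoulliOnePrim (bernoulliCharTwo ψ εK ω)‖ ≤ ((163 : ℕ) : ℝ)⁻¹) := by
  obtain ⟨f, hf, ψ, ω, εK, hψ, hω, hss, ⟨h1, h1'⟩, h3, hεK, h4, -⟩ :=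
    KrizLiBinders.exists_krizLiCharacterBlock_A163 W hiso K hK.1 hdK
  have hodd : Odd (NumberField.discr K) := by rw [hdK]; decide
  have hd4 : NumberField.discr K < -4 := by rw [hdK]; norm_num
  exact ⟨W.conductorNorm ℤ, inferInstance, K, inferInstance, inferInstance, Dt, H, ι, P, f, hf, ψ, ω, εK, rfl, hK,
    KrizLiBinders.satisfiesHeegnerHypothesis_A163 W hiso K hK.1 hdK, hodd, hd4, hLt, hP, hψ, hω, hss, h1, h1', h3, hεK, h4⟩

end Summit.BirchSwinnertonDyer.BirchSwinnertonDyer.Theorems.PrintCFram.KrizLiBindersTwisted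

end
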